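/-
Copyright (c) 2026 the pub-hodgecm-mathlib formalisation cell (harness21).  Prover seat hodgecm-mathlib-K2E1b-p07 (g0), Track B ∕ K2-LIT
(build stream 29), h413 = `stmt-HodgeConjecture-24833`, line `K2_E1b_GKCohomologyU21`, file #24 — the E1b CLOSER BY NAME in ★ currency:
`theorem archClausesLetter : ArchClausesLetter` — the tier-0 §4 glue re-homed Theorems-side (Theorems never import Lines) applied to ★ #19 ∕ #20 ∕ #21,
plus the by-name table variant `archClauses_tableOfRecord` over ★ #23.
Dealt BY NAME by K2E1b-plan (g0) 2026-09-03T21:31:53Z.  2026-09-03.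
-/
import Summits.HodgeConjecture.HodgeConjecture.Theorems.K2E1bGKCohomologyU21Defs   -- ★ leaf #1 (p854739): `centralExp`, `casimirExp`, `IsChiPinnedCohUnitary`, `NoDegOneClass`, `ArchPacketTable`, `ArchClausesLetter`
import Summits.HodgeConjecture.HodgeConjecture.Theorems.K2E1bWignerAssembly        -- ★ #19 (K2E1b-p13): `wignerAssembly` = tier-0 `stub_wigner` PAID
import Summits.HodgeConjecture.HodgeConjecture.Theorems.K2E1bJCarrierClass         -- ★ #20 (K2E1b-p08): `JCarrierClass` = tier-0 `stub_jTable` PAID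
import Summits.HodgeConjecture.HodgeConjecture.Theorems.K2E1bDsCarrierClass        -- ★ #21 (K2E1b-p15, p855002): `DsCarrierClass` = tier-0 `stub_dsTable` PAID
import Summits.HodgeConjecture.HodgeConjecture.Theorems.K2E1bCarriersOfRecord      -- ★ #23 (K2E1b-p13): `tableOfRecord : ArchPacketTable` (the carriers BY NAME)
import HarnessLib

/-!
# h413 ∕ Track B «K2-LIT», line `K2_E1b_GKCohomologyU21`, file #24: THE ARCHIMEDEAN CLAUSES LETTER, Theorems-side (the E1b closer by name)

Cell `pub/hodgecm-mathlib`, crux H413 = `stmt-HodgeConjecture-24833`, route of record `HCCMUnconditional`; chair K2-lead (g0), dealer K2E1b-plan (g0)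
(DEAL 2026-09-03T21:31:53Z «#24 `Theorems/K2E1bArchClausesLetter.lean` (S–M; the E1b CLOSER BY NAME in ★ currency … proof = the tier-0 §4 glue
… which you re-home into the Theorems file since Theorems never import Lines) applied to ★ #19 + (when ★) #20 + #21; PRE-STAGE NOW with
`(hJ : ‹stub_jTable bytes›) (hD : ‹stub_dsTable bytes›)` as hypotheses»).  THEOREMS ONLY (no `def`, no `instance`, no `notation`, no named-fact
hypothesis, no `sorry`); imports = ★ leaf `Theorems/K2E1bGKCohomologyU21Defs` + ★ #19 `K2E1bWignerAssembly` + ★ #20 `K2E1bJCarrierClass` + ★ #21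
`K2E1bDsCarrierClass` + ★ #23 `K2E1bCarriersOfRecord` + HarnessLib; lane `--supports stmt-HodgeConjecture-24833 --as helper` (count-neutral: the E1b
letter is ONE organ of h413's archimedean side; it retires no printed citation by itself).

WHAT THIS FILE PROVES (one edition, sorry-free; all three tier-0 stubs being ★, nothing is left conditional):
* §1 ARITHMETIC OF THE LOCUS (re-homed from tier 0 §4, bodies verbatim): `triple_eq_of_sum_zero_of_sq_two` (integers `a ≥ b ≥ c`, `a+b+c = 0`,
  `a²+b²+c² = 2` ⇒ `(a,b,c) = (1,0,−1)`), `isCohTrivial_of_chi_eq_zero` (`κ(φ) = e(φ) = 0 ⇒ φ = (1,0,−1)`, i.e. ★ `ArchSignRecipe.IsCohTrivial`),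
  `chi_ne_zero_of_not_isCohTrivial`, `isCohUnitaryClass_of_chi` (a χ-pinned coh-unitary class is ★ `IsCohUnitaryClass`).
* §2 THE FOUR CLAUSES FOR ANY LEVEL-A TABLE, «WIGNER» DISCHARGED BY ★ #19 `wignerAssembly` (tier 0 carried it as the hypothesis `hW`):
  `jInfNoDegOne_of_table (T : ArchPacketTable) : JInfNoDegOne T.jInf` (off the locus one χ-scalar is non-zero, so Wigner kills `H¹_{±1}`; `JInfNoDegOne`
  only asks off the locus), `dsInfNoDegOne_of_table T : DsInfNoDegOne T.dsInf` (off the locus Wigner, on it the table's field `dsInf_locus` =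
  Prop. 15.2.1 (a)), `archClauses_of_table T : hJ ∧ hD ∧ hJU ∧ hDU` — exactly the four socket fields of K9's `Rung0WitnessS` for `(T.jInf, T.dsInf)`.
* §3 THE LETTER FROM THE TWO CONSTRUCTIONS: `nonempty_archPacketTable hJ hD : Nonempty ArchPacketTable` and
  `archClausesLetter_of_tables (hJ : ‹stub_jTable bytes›) (hD : ‹stub_dsTable bytes›) : ArchClausesLetter` — the tier-0 head
  `archClausesLetter_of_line hJ hD hW` with its third argument PAID (hypotheses = the two tier-0 CONSTRUCTION stubs, bytes verbatim; home cert
  `K2/K2E1b-p07/g0/Cert_K2E1bArchClausesLetter.lean`: `type_of% @stub_jTable = ‹hJ› := rfl`, `type_of% @stub_dsTable = ‹hD› := rfl`, tier 0 BUILT).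
* §4 THE CLOSERS BY NAME: **`archClausesLetter : ArchClausesLetter`** `:= archClausesLetter_of_tables JCarrierClass DsCarrierClass` (★ #20 pays `stub_jTable`,
  ★ #21 pays `stub_dsTable`, each LITERALLY of the stub's type — reviewer-certified), and the TABLE VARIANT **`archClauses_tableOfRecord :
  JInfNoDegOne tableOfRecord.jInf ∧ DsInfNoDegOne tableOfRecord.dsInf ∧ (∀ p q t, IsCohUnitaryClass (tableOfRecord.jInf p q t)) ∧
  (∀ p q t, IsCohUnitaryClass (tableOfRecord.dsInf p q t))`** `:= archClauses_of_table tableOfRecord` over ★ #23's NAMED carriers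
  (`jInfOfRecord`, `dsInfOfRecord` — the classes of Kovačević's data of record twisted by `e(φ)∕3`), the form a consumer who wants the carriers BY NAME
  rather than behind an `∃` docks on.  Tier 0's `archClausesLetter_paid` re-ties to `archClausesLetter` by import (its sorries are already 0 via ★ #19–#21).

WHY THE LINE WANTS IT (tier-0 docstring «The socket and what E1b owns»).  Rung 0's K9 witness (`k9_of_stfS` ∕ `Rung0WitnessS`) consumes archimedean
carriers `jInf dsInf : ℤ³ → Cinf` with four clauses `hJ : JInfNoDegOne jInf`, `hD : DsInfNoDegOne dsInf`, `hJU hDU` (coh-unitarity); ★ `ArchClausesLetter`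
is their conjunction with the carriers pinned to print's infinitesimal-character invariants `(κ(φ), e(φ))` [Rogawski1990 §12.3 p. 178].  Theorems files
cannot import the tier-0 Lines module, so the consumer needs the closer as a ★ Theorems constant — this file.

HONEST LABEL.  HC_CM is proved only modulo the 7 printed citations (2 remaining named inputs: hLiu418 = `stmt-HodgeConjecture-24832`, h413 =
`stmt-HodgeConjecture-24833`) until rung 0 closes; this file moves no counter (it is the Theorems-side name of the E1b letter, LEVEL A = clause level;
carrier IDENTITY with print's Langlands quotients ∕ discrete series is LEVEL B, tier-1 `sig_K2E1b*`, not asserted here).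

## References
* [Rogawski1990] J. Rogawski, *Automorphic Representations of Unitary Groups in Three Variables*, Ann. of Math. Stud. 123 (1990) — §12.3 pp. 176–178
  (the packets at `∞`, `J^±_φ`, `Π(φ)`, the `πⁿ ∕ πˢ` table), Prop. 15.2.1 (a)(b) p. 249 (cohomology of the members; the locus `φ = (1,0,−1)`).
* [BorelWallach2000] A. Borel, N. Wallach, *Continuous Cohomology, Discrete Subgroups, and Representations of Reductive Groups*, 2nd ed., AMS 2000 —
  I Thm. 5.3 (ii), II Cor. 3.3 (Wigner), VI Thm. 4.11 (2) (cohomology of the discrete series of `SU(2,1)`).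
* [Kovacevic2021] D. Kovačević, *Unitary `(𝔤, K)`-modules of `SU(2,1)`*, Acta Math. Spalatensia 1 (2021) — §3 Thm. 3, §4 Thm. 4–5 (the algebraic
  data behind ★ #20 ∕ #21 ∕ #23; context for §4 only).
-/

set_option autoImplicit false
-- the mandated namespace repeats the single-problem summit's segment (`HodgeConjecture.HodgeConjecture`)
set_option linter.dupNamespace false

noncomputable section

open Literature.NumberTheory.Automorphic
open Literature.NumberTheory.Rogawski1990
open Literature.RepresentationTheory.BorelWallach2000
open Literature.RepresentationTheory.KonnoKonno2007 Literature.RepresentationTheory.KonnoKonno2007.RealDualPair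
open Literature.RepresentationTheory.KonnoKonno2007.RealDualPair.UForm
open Summit.HodgeConjecture.HodgeConjecture.Cruxes.H413.F0P3UnitaryLocOfRecord (IsCohUnitaryClass)
open Summit.HodgeConjecture.HodgeConjecture.Cruxes.H413.F0P3XiArchPacketOfRecord (JInfNoDegOne DsInfNoDegOne)
open Summit.HodgeConjecture.HodgeConjecture.Cruxes.H413.K2E1bGKCohomologyU21
  (centralExp casimirExp IsChiPinnedCohUnitary NoDegOneClass ArchPacketTable ArchClausesLetter)
open Summit.HodgeConjecture.HodgeConjecture.Cruxes.H413.K2E1bWignerAssembly (wignerAssembly)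
open Summit.HodgeConjecture.HodgeConjecture.Cruxes.H413.K2E1bJCarrierClass (JCarrierClass)
open Summit.HodgeConjecture.HodgeConjecture.Cruxes.H413.K2E1bDsCarrierClass (DsCarrierClass)
open Summit.HodgeConjecture.HodgeConjecture.Cruxes.H413.K2E1bCarriersOfRecord (tableOfRecord)

namespace Summit.HodgeConjecture.HodgeConjecture.Cruxes.H413.K2E1bArchClausesLetter

/-! ## §1 Arithmetic of the locus and the χ-pin ⇒ coh-unitary class (tier 0 §4, re-homed) -/

/-- **Arithmetic of the locus**: integers `a ≥ b ≥ c` with `a + b + c = 0` and `a² + b² + c² = 2` are `(1, 0, −1)`. [folklore] -/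
theorem triple_eq_of_sum_zero_of_sq_two {a b c : ℤ} (hab : b ≤ a) (hbc : c ≤ b) (hs : a + b + c = 0)
    (hq : a ^ 2 + b ^ 2 + c ^ 2 = 2) : a = 1 ∧ b = 0 ∧ c = -1 := by
  have ha : a ^ 2 ≤ 2 := by nlinarith [sq_nonneg b, sq_nonneg c]
  have hb : b ^ 2 ≤ 2 := by nlinarith [sq_nonneg a, sq_nonneg c]
  have hc : c ^ 2 ≤ 2 := by nlinarith [sq_nonneg a, sq_nonneg b]
  have ha' : -1 ≤ a ∧ a ≤ 1 := by constructor <;> nlinarith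
  have hb' : -1 ≤ b ∧ b ≤ 1 := by constructor <;> nlinarith
  have hc' : -1 ≤ c ∧ c ≤ 1 := by constructor <;> nlinarith
  obtain ⟨ha1, ha2⟩ := ha'
  obtain ⟨hb1, hb2⟩ := hb'
  obtain ⟨hc1, hc2⟩ := hc'
  interval_cases a <;> interval_cases b <;> interval_cases c <;> omega

/-- **χ-rigidity of the locus**: `κ(φ) = 0` and `e(φ) = 0` force `φ = (1,0,−1)`, i.e. `IsCohTrivial p q t` — the arithmetic third of Wigner's lemma
(`H¹ ≠ 0 ⇒` the infinitesimal character of the trivial representation). [cite: Rogawski1990, Prop. 15.2.1 (b); §12.3 p. 178] -/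
theorem isCohTrivial_of_chi_eq_zero {p q t : ℤ} (hκ : casimirExp p q t = 0) (he : centralExp p q t = 0) :
    ArchSignRecipe.IsCohTrivial p q t := by
  have hanti := ArchSignRecipe.rogTriple_antitone p q t
  unfold casimirExp at hκ
  unfold centralExp at he
  obtain ⟨h1, h2, h3⟩ := triple_eq_of_sum_zero_of_sq_two hanti.2 hanti.1 he (by linarith)
  unfold ArchSignRecipe.IsCohTrivial
  ext <;> simp [h1, h2, h3]

/-- Off the locus one of the χ-scalars is non-zero. [cite: Rogawski1990, Prop. 15.2.1 (b)] -/
theorem chi_ne_zero_of_not_isCohTrivial {p q t : ℤ} (h : ¬ ArchSignRecipe.IsCohTrivial p q t) :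
    casimirExp p q t ≠ 0 ∨ centralExp p q t ≠ 0 := by
  rcases eq_or_ne (casimirExp p q t) 0 with hκ | hκ
  · rcases eq_or_ne (centralExp p q t) 0 with he | he
    · exact absurd (isCohTrivial_of_chi_eq_zero hκ he) h
    · exact Or.inr he
  · exact Or.inl hκ

/-- A χ-pinned coh-unitary class is coh-unitary in the sense of the kit of record (★ `IsCohUnitaryClass`). [cite: Rogawski1990, Prop. 13.8.1 p. 212] -/
theorem isCohUnitaryClass_of_chi {x : GKIrrClass (uFormGroup (Fin 2) (Fin 1))} {κ e : ℤ} (h : IsChiPinnedCohUnitary x κ e) :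
    IsCohUnitaryClass x := by
  obtain ⟨r, hr, hu, _⟩ := h
  exact ⟨r, hr, hu⟩

/-! ## §2 The four clauses for any level-A table — «WIGNER» discharged by ★ #19 `wignerAssembly` -/

/-- **Clause `hJ`** for any level-A table: `JInfNoDegOne T.jInf` — off the locus one χ-scalar of `J^±_φ` is non-zero (§1), so Wigner (★ #19
`wignerAssembly`) kills `H¹_{±1}` of every module in the class. [cite: Rogawski1990, Prop. 15.2.1 (b)] [cite: BorelWallach2000, I Thm. 5.3 (ii); II Cor. 3.3] -/
theorem jInfNoDegOne_of_table (T : ArchPacketTable) : JInfNoDegOne T.jInf := by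
  intro p q t hnot M _ _ σK σ𝔤 hM hirr hx δ hδ
  exact wignerAssembly _ _ _ (T.jInf_chi p q t) (chi_ne_zero_of_not_isCohTrivial hnot) M σK σ𝔤 hM hirr hx δ hδ

/-- **Clause `hD`** for any level-A table: `DsInfNoDegOne T.dsInf` — off the locus by Wigner (★ #19), on it by the table's locus field `dsInf_locus`
(Prop. 15.2.1 (a): `H^j(D) = ℂ` iff `j = 2`). [cite: Rogawski1990, Prop. 15.2.1 (a)(b)] [cite: BorelWallach2000, VI Thm. 4.11 (2)] -/
theorem dsInfNoDegOne_of_table (T : ArchPacketTable) : DsInfNoDegOne T.dsInf := by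
  intro p q t M _ _ σK σ𝔤 hM hirr hx δ hδ
  by_cases h : ArchSignRecipe.IsCohTrivial p q t
  · exact T.dsInf_locus p q t h M σK σ𝔤 hM hirr hx δ hδ
  · exact wignerAssembly _ _ _ (T.dsInf_chi p q t) (chi_ne_zero_of_not_isCohTrivial h) M σK σ𝔤 hM hirr hx δ hδ

/-- **The four archimedean clauses of rung 0 for any level-A table**: `hJ ∧ hD ∧ hJU ∧ hDU` — the hypotheses of ★ `archPacketCoh_of` ∕ `archMember_of` ∕
`Rung0WitnessS` for the carriers `(T.jInf, T.dsInf)`. [cite: Rogawski1990, §12.3 p. 178; Prop. 15.2.1] -/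
theorem archClauses_of_table (T : ArchPacketTable) :
    JInfNoDegOne T.jInf ∧ DsInfNoDegOne T.dsInf ∧
      (∀ p q t : ℤ, IsCohUnitaryClass (T.jInf p q t)) ∧ (∀ p q t : ℤ, IsCohUnitaryClass (T.dsInf p q t)) :=
  ⟨jInfNoDegOne_of_table T, dsInfNoDegOne_of_table T,
    fun p q t => isCohUnitaryClass_of_chi (T.jInf_chi p q t), fun p q t => isCohUnitaryClass_of_chi (T.dsInf_chi p q t)⟩

/-! ## §3 The letter from the two CONSTRUCTION stubs (tier 0 `stub_jTable`, `stub_dsTable`, bytes verbatim as hypotheses) -/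

/-- **A level-A table from the two constructions** (sorry-free packaging). [cite: Rogawski1990, §12.3 p. 178] -/
theorem nonempty_archPacketTable
    (hJ : ∃ jInf : ℤ → ℤ → ℤ → GKIrrClass (uFormGroup (Fin 2) (Fin 1)),
      ∀ p q t : ℤ, IsChiPinnedCohUnitary (jInf p q t) (casimirExp p q t) (centralExp p q t))
    (hD : ∃ dsInf : ℤ → ℤ → ℤ → GKIrrClass (uFormGroup (Fin 2) (Fin 1)),
      (∀ p q t : ℤ, IsChiPinnedCohUnitary (dsInf p q t) (casimirExp p q t) (centralExp p q t)) ∧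
        ∀ p q t : ℤ, ArchSignRecipe.IsCohTrivial p q t → NoDegOneClass (dsInf p q t)) :
    Nonempty ArchPacketTable := by
  obtain ⟨jInf, hj⟩ := hJ
  obtain ⟨dsInf, hd, hl⟩ := hD
  exact ⟨⟨jInf, dsInf, hj, hd, hl⟩⟩

/-- **THE LETTER FROM THE TWO TABLE STUBS** (tier 0's head `archClausesLetter_of_line ‹stub_jTable› ‹stub_dsTable› ‹stub_wigner›` with «WIGNER» PAID
by ★ #19): if the `J`-table and the `D`-table exist as χ-pinned coh-unitary irreducible classes (the `D`-table with no `H¹_{±1}` on the locus), then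
★ `ArchClausesLetter` holds.  Hypotheses = tier-0 `stub_jTable` ∕ `stub_dsTable` TOKEN FOR TOKEN; the unconditional closer `archClausesLetter` (§4) is this at ★ #20 ∕ ★ #21. [cite: Rogawski1990, §12.3 p. 178; Prop. 15.2.1] [cite: BorelWallach2000, VI Thm. 4.11; I Thm. 5.3] -/
theorem archClausesLetter_of_tables
    (hJ : ∃ jInf : ℤ → ℤ → ℤ → GKIrrClass (uFormGroup (Fin 2) (Fin 1)),
      ∀ p q t : ℤ, IsChiPinnedCohUnitary (jInf p q t) (casimirExp p q t) (centralExp p q t))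
    (hD : ∃ dsInf : ℤ → ℤ → ℤ → GKIrrClass (uFormGroup (Fin 2) (Fin 1)),
      (∀ p q t : ℤ, IsChiPinnedCohUnitary (dsInf p q t) (casimirExp p q t) (centralExp p q t)) ∧
        ∀ p q t : ℤ, ArchSignRecipe.IsCohTrivial p q t → NoDegOneClass (dsInf p q t)) :
    ArchClausesLetter := by
  obtain ⟨T⟩ := nonempty_archPacketTable hJ hD
  obtain ⟨h1, h2, h3, h4⟩ := archClauses_of_table T
  exact ⟨T.jInf, T.dsInf, T.jInf_chi, T.dsInf_chi, h1, h2, h3, h4⟩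

/-! ## §4 The closers BY NAME: the E1b letter, and the four clauses for the table of record -/

/-- **THE E1b LETTER, PAID (level A): `ArchClausesLetter`.**  There are archimedean carriers `jInf dsInf : ℤ³ → Cinf`, χ-pinned at print's
infinitesimal-character invariants `(κ(φ), e(φ))` of the §12.3 p. 178 table, satisfying the four clauses `JInfNoDegOne`, `DsInfNoDegOne`,
coh-unitarity ×2 of rung 0's K9 witness — §3 at the two ★ CONSTRUCTIONS: ★ #20 `JCarrierClass` (the `J`-table: Kovačević's `jDatum` twisted by `e(φ)∕3`,
`K`-integrated, irreducible, admissible, unitary along `𝔭 ⊕ ℝz₀`, Casimir `κ(φ)`) and ★ #21 `DsCarrierClass` (the `D`-table, with Prop. 15.2.1 (a) on the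
locus from the `K`-type criterion ★ #14), «WIGNER» ★ #19 inside.  This is tier 0's `archClausesLetter_paid` as a ★ Theorems constant.
[cite: Rogawski1990, §12.3 pp. 176–178; Prop. 15.2.1 (a)(b) p. 249] [cite: BorelWallach2000, VI Thm. 4.11 (2); I Thm. 5.3 (ii)] [cite: Kovacevic2021, §3 Thm. 3; §4 Thm. 4–5] -/
theorem archClausesLetter : ArchClausesLetter :=
  archClausesLetter_of_tables JCarrierClass DsCarrierClass

/-- **THE FOUR CLAUSES FOR THE TABLE OF RECORD (by-name variant).**  For ★ #23's named level-A table `tableOfRecord` (`jInf := jInfOfRecord`,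
`dsInf := dsInfOfRecord`: the classes of the twisted Kovačević data of record), the four archimedean clauses of rung 0 hold:
`hJ ∧ hD ∧ hJU ∧ hDU` — §2 at `T := tableOfRecord`.  Consumers who need the carriers BY NAME (E1's archimedean character identities, junction J1)
dock here; consumers who need only the `∃` dock on `archClausesLetter`.
[cite: Rogawski1990, §12.3 p. 178; Prop. 15.2.1 (a)(b) p. 249] [cite: BorelWallach2000, VI Thm. 4.11 (2); I Thm. 5.3 (ii)] -/
theorem archClauses_tableOfRecord :
    JInfNoDegOne tableOfRecord.jInf ∧ DsInfNoDegOne tableOfRecord.dsInf ∧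
      (∀ p q t : ℤ, IsCohUnitaryClass (tableOfRecord.jInf p q t)) ∧ (∀ p q t : ℤ, IsCohUnitaryClass (tableOfRecord.dsInf p q t)) :=
  archClauses_of_table tableOfRecord

end Summit.HodgeConjecture.HodgeConjecture.Cruxes.H413.K2E1bArchClausesLetter

end
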